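import Mathlib
import HarnessLib
import Summits.HubbardSuperconductivity.HubbardSuperconductivity.Theorems.KLProgrammeKLRegimeSplitBundleV7
import Summits.HubbardSuperconductivity.HubbardSuperconductivity.Theorems.KLProgrammeKLRegimeSplitPairArrayV5
import Summits.HubbardSuperconductivity.HubbardSuperconductivity.Theorems.KLProgrammeKLRegimeBetaSplitV6
import Summits.HubbardSuperconductivity.HubbardSuperconductivity.Theorems.KLProgrammeKLRegimeSplitChildOneStepS2

/-!
# Route `KLProgramme` — crux K3, child 1 `KLRegimeBetaSplit` CLOSED on the V7 slots (Δ15: `Q`-staged leg majorant, `Q`-aware pair tolerance):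
# `BetaSplitP Pr W` for every bundle whose split slot is implied by `BetaSplitAtS2` and whose engine slot implies `EngineBoundsAtV5S` —
# in particular `betaSplitP_klPredsV7 : ∀ W, BetaSplitP klPredsV7 W` (the route item `KLRegimeBetaSplitV7` at `W = klWindowC`)

Cell gate-hubbard-kl, seat hubbard-kl-r2d-p1 (child-1 owner).  Same composition as `…KLRegimeBetaSplitV6` (`betaSplitP_of_slotsS`) with row 0′
read on the V5 engine clauses (`pairArrayAtV2_of_engineBoundsV5S_explicit`, `…SplitPairArrayV5`) and the split slot's pair clause `PairArrayAtV2`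
(tolerance `(C_W + klLegKappa·CR·Klam³)·U²`): p1b's per-scale step `betaSplitAtS2_of_engineV5S`
(`…SplitChildOneStepS2`, p451187: the S2 closers + p1's `firstMoments_of_engineFirstMoments`).  Constants:
`P = (2·CF+3, cW5(G), cE4+1, 0)`, `cW5 = 8(Σ_χ(abot+atop)+1) + 17(aplus Klam² Z + cloc Klam²(1−4^{−θ})⁻¹ + 1) + 1 + 23·CF·Klam²`;
`c₀ = ln 4/(160·Crow5·(bhi+1))`, `Crow5 = (Σ_χ(abot+atop)+1) + 2(aplus Klam² Z + cloc Klam²(1−4^{−θ})⁻¹ + 1) + 1 + 3·CF·Klam² + 48·CR·Klam³`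
(chosen after `Q` ✓); `U₀ = min(1, 1/(2·CR·Klam³+1), 1/(Q.cE4+1), 1/(Dval+1))` with `Dval = C′ + CF·C′ + CF·Klam²`, `C′ = C_W + klLegKappa·CR·Klam³`;
`L₁ β U = ⌈17·Σ_{j≤n_β} CL β j/U²⌉₊`, `M₁ = 0`.  Everything is proved; no definitions.
-/

noncomputable section

namespace Summit.HubbardSuperconductivity.HubbardSuperconductivity.Theorems.KLRegimeSplit

set_option linter.dupNamespace false -- summit = problem name (single-conjunct summit), D-0017

open Real Finset Literature.MathematicalPhysics.QuantumLattice Literature.Probability.LatticeModels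
open Summit.HubbardSuperconductivity.HubbardSuperconductivity.Theorems.KLProgrammeLegKernels
open Summit.HubbardSuperconductivity.HubbardSuperconductivity.Theorems.DispersionFlow

/-! ## The child-1 theorem on the V7 slots, generic in the bundle -/

/-- **Child 1 on the V7 slots, for every bundle and window.**  If the bundle's split slot is implied by `BetaSplitAtS2` and its engine slot implies
`EngineBoundsAtV5S` (for `klPredsV7` both by `rfl`), then `BetaSplitP Pr W`. -/
theorem betaSplitP_of_slotsS2 {Pr : Preds} {W : Set ℝ}
    (hs : ∀ (L M : ℕ) [NeZero L] [NeZero M] (G : GeoConsts) (P : SplitConsts) (Q : EngConsts) (β U μ : ℝ) (K : TrigPolyC4v) (n : ℕ),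
      BetaSplitAtS2 L M G P Q β U μ K n → Pr.split L M G P Q β U μ K n)
    (he : ∀ (L M : ℕ) [NeZero L] [NeZero M] (G : GeoConsts) (P : SplitConsts) (Q : EngConsts) (β U μ : ℝ) (K : TrigPolyC4v) (n : ℕ),
      Pr.engine L M G P Q β U μ K n → EngineBoundsAtV5S L M G P Q β U μ K n) :
    BetaSplitP Pr W := by
  intro G hG
  -- nonnegativity of the `G`-constants
  have hCF : 0 ≤ G.CF := hG.2.2.2.2.2.2.2.2.2.2.2.2.2.1
  have hcloc : 0 ≤ G.cloc := hG.2.2.2.2.1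
  have haplus : 0 ≤ G.aplus := hG.2.2.2.2.2.2.2.2.2.2.1
  have hθ : 0 < G.θ := hG.2.2.2.2.2.1
  have hbhi : 0 ≤ G.bhi := le_trans hG.2.2.1 hG.2.2.2.1
  have hcE4 : 0 ≤ G.cE4 := hG.2.2.2.2.2.2.2.2.2.2.2.2.2.2.2.2.1
  have hZ : 0 ≤ G.Z := le_trans (sum_nonneg fun j _ => hG.2.2.2.2.2.2.2.2.1 j) (hG.2.2.2.2.2.2.2.2.2.1 0)
  have hab : 0 ≤ ∑ χ : D4Irrep, (G.abot χ + G.atop χ) := sum_nonneg fun χ _ => add_nonneg (hG.2.1 χ) (hG.1 χ)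
  have hg : 0 ≤ (1 - (4 : ℝ) ^ (-G.θ))⁻¹ :=
    inv_nonneg.2 (by have := Real.rpow_lt_one_of_one_lt_of_neg (x := (4 : ℝ)) (by norm_num) (by linarith : -G.θ < 0); linarith)
  -- the induction constants `P` (kept opaque)
  obtain ⟨Klam, hKlam⟩ : ∃ x : ℝ, x = 2 * G.CF + 3 := ⟨_, rfl⟩
  have hKlam1 : 1 ≤ Klam := by rw [hKlam]; linarith
  have hKlam0 : 0 ≤ Klam := zero_le_one.trans hKlam1
  have hK2 : 0 ≤ Klam ^ 2 := sq_nonneg _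
  have hx1 : 0 ≤ G.aplus * Klam ^ 2 * G.Z := mul_nonneg (mul_nonneg haplus hK2) hZ
  have hx2 : 0 ≤ G.cloc * Klam ^ 2 * (1 - (4 : ℝ) ^ (-G.θ))⁻¹ := mul_nonneg (mul_nonneg hcloc hK2) hg
  obtain ⟨CW, hCW⟩ : ∃ x : ℝ, x = 8 * (∑ χ : D4Irrep, (G.abot χ + G.atop χ) + 1) +
      17 * (G.aplus * Klam ^ 2 * G.Z + G.cloc * Klam ^ 2 * (1 - (4 : ℝ) ^ (-G.θ))⁻¹ + 1) + 1 + 23 * (G.CF * Klam ^ 2) := ⟨_, rfl⟩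
  have hCW0 : 0 ≤ CW := by rw [hCW]; positivity
  refine ⟨⟨Klam, CW, G.cE4 + 1, 0⟩, ⟨hKlam1, hCW0, by positivity⟩, ?_⟩
  intro Q hQ
  have hPWF : (⟨Klam, CW, G.cE4 + 1, 0⟩ : SplitConsts).WF := ⟨hKlam1, hCW0, by positivity⟩
  have hCR : 0 ≤ Q.CR := hQ.2.1
  have hQcE4 : 0 ≤ Q.cE4 := hQ.2.2.2.1
  have hCL : ∀ β n, 0 ≤ Q.CL β n := hQ.2.2.2.2.2.2.2
  -- the no-onset constant `c₀` (after `Q`: it reads `Q.CR`)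
  obtain ⟨Crow, hCrow_def⟩ : ∃ x : ℝ, x = (∑ χ : D4Irrep, (G.abot χ + G.atop χ) + 1) +
      2 * (G.aplus * Klam ^ 2 * G.Z + G.cloc * Klam ^ 2 * (1 - (4 : ℝ) ^ (-G.θ))⁻¹ + 1) + 1 + 3 * (G.CF * Klam ^ 2) +
        48 * (Q.CR * Klam ^ 3) := ⟨_, rfl⟩
  have hK3 : 0 ≤ Q.CR * Klam ^ 3 := by positivity
  have hCrow1 : 1 ≤ Crow := by rw [hCrow_def]; nlinarith [mul_nonneg hCF hK2]
  have hCrow : 0 ≤ Crow := zero_le_one.trans hCrow1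
  have hlog4 : 0 < Real.log 4 := Real.log_pos (by norm_num)
  refine ⟨Real.log 4 / (160 * Crow * (G.bhi + 1)), by positivity, ?_⟩
  intro c hc hcc₀ R hR
  -- `U₀`
  obtain ⟨CW', hCW'_def⟩ : ∃ x : ℝ, x = CW + klLegKappa * Q.CR * Klam ^ 3 := ⟨_, rfl⟩
  have hκ0 : 0 ≤ klLegKappa := by unfold klLegKappa; norm_num
  have hCW'0 : 0 ≤ CW' := by
    rw [hCW'_def]; exact add_nonneg hCW0 (mul_nonneg (mul_nonneg hκ0 hCR) (pow_nonneg hKlam0 3))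
  obtain ⟨Dval, hDval_def⟩ : ∃ x : ℝ, x = CW' + G.CF * CW' + G.CF * Klam ^ 2 := ⟨_, rfl⟩
  have hDval : 0 ≤ Dval := by
    rw [hDval_def]; exact add_nonneg (add_nonneg hCW'0 (mul_nonneg hCF hCW'0)) (mul_nonneg hCF hK2)
  obtain ⟨U₀, hU₀_def⟩ : ∃ x : ℝ, x = min 1 (min (1 / (2 * Q.CR * Klam ^ 3 + 1)) (min (1 / (Q.cE4 + 1)) (1 / (Dval + 1)))) :=
    ⟨_, rfl⟩
  have hU₀ : 0 < U₀ := by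
    rw [hU₀_def]
    exact lt_min one_pos (lt_min (by positivity) (lt_min (by positivity) (by positivity)))
  refine ⟨U₀, hU₀, fun β U => ⌈17 * (∑ j ∈ range (nScales β + 1), Q.CL β j) / U ^ 2⌉₊, fun _ _ _ => 0, ?_⟩
  intro μ hμ U hU hUle β hβmin hβc K hK L M _ _ hL hM n hn hKL hHist hE hT
  -- the smallness lines out of `U ≤ U₀`
  rw [hU₀_def] at hUle
  have hU1 : U ≤ 1 := hUle.trans (min_le_left _ _)
  have hUa : |U| = U := abs_of_pos hU
  have hUa1 : |U| ≤ 1 := by rw [hUa]; exact hU1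
  have hUCR : 2 * Q.CR * Klam ^ 3 * |U| ≤ 1 := by
    rw [hUa]
    exact klbs_mul_le_one_of_le_inv (by positivity) hU.le (hUle.trans ((min_le_right _ _).trans (min_le_left _ _)))
  have hUcE4 : Q.cE4 * |U| ≤ 1 := by
    rw [hUa]
    exact klbs_mul_le_one_of_le_inv hQcE4 hU.le
      (hUle.trans ((min_le_right _ _).trans ((min_le_right _ _).trans (min_le_left _ _))))
  have hUD : Dval * U ≤ 1 :=
    klbs_mul_le_one_of_le_inv hDval hU.le
      (hUle.trans ((min_le_right _ _).trans ((min_le_right _ _).trans (min_le_right _ _))))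
  have hc' : 160 * Crow * (G.bhi + 1) * c ≤ Real.log 4 := by
    have hpos : 0 < 160 * Crow * (G.bhi + 1) := by positivity
    have := (le_div_iff₀ hpos).1 hcc₀
    linarith
  -- the engine bounds at every scale `j ≤ n` (history + the scale-`n` hypothesis)
  have hEn : EngineBoundsAtV5S L M G ⟨Klam, CW, G.cE4 + 1, 0⟩ Q β U μ K n := he L M G _ Q β U μ K n hE
  have hEall : ∀ j ≤ n, EngineBoundsAtV5S L M G ⟨Klam, CW, G.cE4 + 1, 0⟩ Q β U μ K j := by
    intro j hj
    rcases Nat.lt_or_ge j n with hlt | hge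
    · exact he L M G _ Q β U μ K j (hHist j hlt).2.2.1
    · have : j = n := le_antisymm hj hge
      subst this
      exact hEn
  -- (B1-v2′) from row 0′ on the V5 engine slot, in the regime
  have hLline : 17 * ∑ j ∈ range n, Q.CL β j / L ≤ U ^ 2 := klbs_volume_line hCL hU hn hL
  have hsmall : 8 * 20 * (((∑ χ : D4Irrep, (G.abot χ + G.atop χ) + 1) +
      2 * (G.aplus * Klam ^ 2 * G.Z + G.cloc * Klam ^ 2 * (1 - (4 : ℝ) ^ (-G.θ))⁻¹ + 1) + 1 + 3 * (G.CF * Klam ^ 2) +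
        48 * (Q.CR * Klam ^ 3)) * U ^ 2) * (G.bhi * n) ≤ 1 := by
    rw [← hCrow_def]; exact klbs_noOnset_line hCrow hbhi hKL hc'
  have hB1 : PairArrayAtV2 L M ⟨Klam, CW, G.cE4 + 1, 0⟩ Q β U μ K n :=
    pairArrayAtV2_of_engineBoundsV5S_explicit L M hG hPWF hQ hU.le hUa1 hn hEall hUCR hLline hsmall (by rw [hCW])
  -- the per-scale step: value line, iso endpoint line, first moments
  have hUD' : (CW' + G.CF * CW' + G.CF * Klam ^ 2) * U ≤ 1 := by rwa [hDval_def] at hUD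
  obtain ⟨hKval, harith⟩ := klbs_value_consts hCF hCW'0 hKlam hU.le hUD'
  have hB : BetaSplitAtS2 L M G ⟨Klam, CW, G.cE4 + 1, 0⟩ Q β U μ K n := by
    have hB0 : 0 ≤ 2 * |U| + (CW + klLegKappa * Q.CR * Klam ^ 3) * U ^ 2 := by
      rw [← hCW'_def]; exact add_nonneg (mul_nonneg zero_le_two (abs_nonneg U)) (mul_nonneg hCW'0 (sq_nonneg U))
    refine betaSplitAtS2_of_engineV5S L M ⟨Klam, CW, G.cE4 + 1, 0⟩ Q hB0 hKlam0 hB1 hEn ?_ ?_ ?_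
    · show G.CF * (2 * |U| + (CW + klLegKappa * Q.CR * Klam ^ 3) * U ^ 2) + G.CF * (Klam * U) ^ 2 ≤ Klam * |U|
      rw [hUa, ← hCW'_def]; exact harith
    · show 2 * |U| + (CW + klLegKappa * Q.CR * Klam ^ 3) * U ^ 2 ≤ Klam * |U|
      rw [hUa, ← hCW'_def]; exact hKval
    · show G.cE4 + Q.cE4 * |U| ≤ G.cE4 + 1
      linarith
  exact hs L M G _ Q β U μ K n hB

/-- **Child 1 at the V7 bundle**: `BetaSplitP klPredsV7 W` for every covariance window `W` (in particular `klWindowC`: the route item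
`KLRegimeBetaSplitV7`). -/
theorem betaSplitP_klPredsV7 (W : Set ℝ) : BetaSplitP klPredsV7 W :=
  betaSplitP_of_slotsS2 (Pr := klPredsV7) (fun _ _ _ _ _ _ _ _ _ _ _ _ h => h) (fun _ _ _ _ _ _ _ _ _ _ _ _ h => h)

end Summit.HubbardSuperconductivity.HubbardSuperconductivity.Theorems.KLRegimeSplit

end
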